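import Mathlib
import Summits.MatrixMultiplication.MatrixMultiplication.Theses.FourierTwoFamiliesModP
import Summits.MatrixMultiplication.MatrixMultiplication.Theorems.PrimeTwoFamilies.Negative.Slices
import Literature.Computability.AlgebraicComplexity.SimultaneousDoubleProduct
import Summits.MatrixMultiplication.MatrixMultiplication.Theorems.FourierTwoFamiliesModPPrimeTwoFamiliesStubCapacityTransfer

/-!
# Capacity gadgets `↔ PrimeTwoFamilies`, elementary form: one-letter words
# (crux stmt-MatrixMultiplication-14308, registered stub `capacityGadgets_iff_primeTwoFamilies`)

Item `stmt-MatrixMultiplication-14308` (`FourierTwoFamiliesModP.PrimeTwoFamilies`, CKSU 2005 Conj. 4.7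
with prime cyclic hosts), line `Sketch` in its capacity-gadget form.  A CAPACITY GADGET at level `m` is a
list of DIRECT pairs `(P c, Q c)_{c<r}` in `ℤ/m` (`(x - x') + (y - y') = 0` inside a pair forces
`x = x'`, `y = y'`) of co-volume `|P c||Q c| ≥ m^{1-ε}`, together with a set `W` of words
`Fin L → Fin r` (`L ≥ 1`, `|W| ≥ (m^L)^{1/2-ε}`) in which every ordered pair of distinct words `i ≠ k`
is STRONGLY SEPARATED in some coordinate `t`: every cross difference `q - p` (`p ∈ P (i t)`,
`q ∈ Q (k t)`) avoids every diagonal difference `q' - p'` (`p' ∈ P c`, `q' ∈ Q c`).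

This file gives the explicit / elementary proof of the equivalence
`capacityGadgets_iff_primeTwoFamilies` (same statement as the registered stub):

* (⇐) `capacityGadgets_of_primeTwoFamilies` — ONE-LETTER WORDS.  An honest SDPP family
  `(A i, B i)_{i<n}` in `ℤ/p` is itself a capacity gadget with `m = p`, `r = n`, `L = 1`, `P = A`,
  `Q = B` and `W = ` all `n` one-letter words: clause (X) of the simultaneous double product property
  says precisely that for `i ≠ k` the cross differences `B k - A i` avoid every diagonal difference set
  `B c - A c` (`cross_sub_ne_diag_sub`), and the slice inequalities `p ≤ n^{2+δ}`,
  `n^{2-δ} ≤ |A i||B i|` at `δ := min ε 1` give `p^{1/2-ε} ≤ p^{1/(2+δ)} ≤ n = |W|` and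
  `p^{1-ε} ≤ p^{(2-δ)/(2+δ)} ≤ n^{2-δ} ≤ |A c||B c|`; the level `m = p ≥ n ≥ m₀` is large because a
  direct pair has `|A i||B i| ≤ p` (`card_mul_card_le_of_dpp`).  No letter repetition, no
  self-converse gadgets, no two-letter code is needed for this direction.
* (⇒) the landed transfer `CapacityLift.stub_capacityTransfer` (code lift to `Fin L → ℤ/m`,
  carry-free move into a prime host, bookkeeping) gives every slice `0 < δ ≤ 1`, and slices are
  monotone (`PrimeTwoFamiliesAt.mono`).

Read together with (⇒), the converse says that the capacity-gadget form of the crux is the crux with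
the single extra freedom of taking products of letters before transferring to a prime host.
-/

-- single-conjunct summit: the mandated namespace repeats `MatrixMultiplication` (summit = sub-problem).
set_option linter.dupNamespace false

namespace Summit.MatrixMultiplication.MatrixMultiplication.Theorems.PrimeTwoFamilies.CapacityOneLetter

open Finset
open Summit.MatrixMultiplication.MatrixMultiplication.Theses
open Summit.MatrixMultiplication.MatrixMultiplication.Theorems
open Summit.MatrixMultiplication.MatrixMultiplication.Theorems.PrimeTwoFamilies.Negative
open Summit.MatrixMultiplication.MatrixMultiplication.Theorems.PrimeTwoFamilies.CapacityLift
open Literature.Computability.AlgebraicComplexity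

/-- **Clause (X) is strong separation of one-letter words.**  In a family `(A i, B i)_{i<n}`
satisfying clause (X) of the simultaneous double product property (`(a - a') + (b - b') = 0` with
`a ∈ A i`, `a' ∈ A j`, `b ∈ B j`, `b' ∈ B k` forces `i = k`), for `i ≠ k` every cross difference
`b - a` (`a ∈ A i`, `b ∈ B k`) differs from every diagonal difference `b' - a'` (`a' ∈ A c`,
`b' ∈ B c`): a coincidence `b - a = b' - a'` is the relation `(a - a') + (b' - b) = 0` with
`a ∈ A i`, `a' ∈ A c`, `b' ∈ B c`, `b ∈ B k`, which (X) (at `j = c`) turns into `i = k`. -/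
theorem cross_sub_ne_diag_sub {G : Type*} [AddCommGroup G] {n : ℕ} {A B : Fin n → Finset G}
    (hX : ∀ i j k : Fin n, ∀ a ∈ A i, ∀ a' ∈ A j, ∀ b ∈ B j, ∀ b' ∈ B k,
      (a - a') + (b - b') = 0 → i = k)
    {i k : Fin n} (hik : i ≠ k) :
    ∀ a ∈ A i, ∀ b ∈ B k, ∀ c : Fin n, ∀ a' ∈ A c, ∀ b' ∈ B c, b - a ≠ b' - a' := by
  intro a ha b hb c a' ha' b' hb' h
  refine hik (hX i c k a ha a' ha' b' hb' b hb ?_)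
  have e : (a - a') + (b' - b) = (b' - a') - (b - a) := by abel
  rw [e, h, sub_self]

/-- **(⇐) One-letter words: the crux gives capacity gadgets.**  If `PrimeTwoFamilies` holds then for
every `ε > 0` there are arbitrarily large levels `m` carrying a capacity gadget: take the slice
`δ := min ε 1` of the crux above `n₀ := max m₀ 1`, i.e. a prime `p ≤ n^{2+δ}` and an SDPP family
`(A i, B i)_{i<n}` in `ℤ/p` with `n^{2-δ} ≤ |A i||B i|`, and use it verbatim as the gadget:
`m := p`, `r := n`, `L := 1`, `P := A`, `Q := B`, `W := univ` (all `n` one-letter words).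
Directness is clause (W); separation of distinct one-letter words at the coordinate `t = 0` is
clause (X) (`cross_sub_ne_diag_sub`); `|W| = n ≥ p^{1/(2+δ)} ≥ p^{1/2-ε}` since
`(1/2 - ε)(2 + δ) ≤ 1`; `|A c||B c| ≥ n^{2-δ} ≥ p^{(2-δ)/(2+δ)} ≥ p^{1-ε}` since
`(1 - ε)(2 + δ) ≤ 2 - δ`; and `m = p ≥ |A 0||B 0| ≥ n^{2-δ} ≥ n ≥ m₀` by directness
(`card_mul_card_le_of_dpp`). -/
theorem capacityGadgets_of_primeTwoFamilies (hT : FourierTwoFamiliesModP.PrimeTwoFamilies) :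
    ∀ ε : ℝ, 0 < ε → ∀ m₀ : ℕ, ∃ m ≥ m₀, ∃ r L : ℕ, ∃ P Q : Fin r → Finset (ZMod m),
      ∃ W : Finset (Fin L → Fin r),
      (∀ c : Fin r, ∀ x ∈ P c, ∀ x' ∈ P c, ∀ y ∈ Q c, ∀ y' ∈ Q c,
          (x - x') + (y - y') = 0 → x = x' ∧ y = y') ∧
      (∀ i ∈ W, ∀ k ∈ W, i ≠ k → ∃ t : Fin L,
        ∀ p ∈ P (i t), ∀ q ∈ Q (k t), ∀ c : Fin r, ∀ p' ∈ P c, ∀ q' ∈ Q c, q - p ≠ q' - p') ∧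
      1 ≤ L ∧
      ((m : ℝ) ^ (L : ℝ)) ^ (1 / 2 - ε) ≤ (W.card : ℝ) ∧
      ∀ c : Fin r, (m : ℝ) ^ (1 - ε) ≤ (((P c).card * (Q c).card : ℕ) : ℝ) := by
  intro ε hε m₀
  -- the slice `δ := min ε 1` of the crux, above `max m₀ 1`
  obtain ⟨δ, hδ, hδε, hδ1⟩ : ∃ δ : ℝ, 0 < δ ∧ δ ≤ ε ∧ δ ≤ 1 :=
    ⟨min ε 1, lt_min hε one_pos, min_le_left _ _, min_le_right _ _⟩
  obtain ⟨n, hn, p, hp, A, B, hW, hX, hpn, hAB⟩ := hT δ hδ (max m₀ 1)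
  have hn1 : 1 ≤ n := le_trans (le_max_right _ _) hn
  have hn1R : (1 : ℝ) ≤ n := by exact_mod_cast hn1
  have hn0R : (0 : ℝ) ≤ n := n.cast_nonneg
  have hp1R : (1 : ℝ) ≤ p := by exact_mod_cast hp.one_lt.le
  have hp0R : (0 : ℝ) ≤ p := p.cast_nonneg
  have h2δ : (0 : ℝ) < 2 + δ := by positivity
  haveI : Fact p.Prime := ⟨hp⟩
  -- the level is large: `n ≤ n^{2-δ} ≤ |A i||B i| ≤ p` at the index `i = 0`
  have hnp : n ≤ p := by
    have i : Fin n := ⟨0, hn1⟩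
    have h1 : (A i).card * (B i).card ≤ p := by
      have := card_mul_card_le_of_dpp (H := ZMod p) (hW i)
      rwa [ZMod.card] at this
    have h2 : (n : ℝ) ≤ (n : ℝ) ^ (2 - δ) := by
      calc (n : ℝ) = (n : ℝ) ^ (1 : ℝ) := (Real.rpow_one _).symm
        _ ≤ (n : ℝ) ^ (2 - δ) := Real.rpow_le_rpow_of_exponent_le hn1R (by linarith)
    have h3 : (n : ℝ) ≤ (p : ℝ) := h2.trans ((hAB i).trans (by exact_mod_cast h1))
    exact_mod_cast h3
  refine ⟨p, le_trans (le_max_left _ _) (hn.trans hnp), n, 1, A, B, Finset.univ, hW, ?_, le_rfl,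
    ?_, ?_⟩
  · -- separation of distinct one-letter words, at the coordinate `t = 0`, is clause (X)
    intro i _ k _ hik
    refine ⟨0, ?_⟩
    have hik0 : i 0 ≠ k 0 := fun h =>
      hik (funext fun t => by rw [Fin.fin_one_eq_zero t]; exact h)
    exact cross_sub_ne_diag_sub hX hik0
  · -- `p^{1/2-ε} ≤ p^{1/(2+δ)} ≤ n = |W|`
    have hcard : ((Finset.univ : Finset (Fin 1 → Fin n)).card : ℝ) = n := by
      rw [Finset.card_univ, Fintype.card_fun, Fintype.card_fin, Fintype.card_fin, pow_one]
    rw [hcard, Nat.cast_one, Real.rpow_one]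
    have hexp : 1 / 2 - ε ≤ (2 + δ)⁻¹ := by
      rw [inv_eq_one_div, le_div_iff₀ h2δ]
      nlinarith [mul_pos hε hδ]
    calc (p : ℝ) ^ (1 / 2 - ε) ≤ (p : ℝ) ^ (2 + δ)⁻¹ := Real.rpow_le_rpow_of_exponent_le hp1R hexp
      _ ≤ ((n : ℝ) ^ (2 + δ)) ^ (2 + δ)⁻¹ := Real.rpow_le_rpow hp0R hpn (inv_nonneg.mpr h2δ.le)
      _ = n := Real.rpow_rpow_inv hn0R h2δ.ne'
  · -- co-volume: `p^{1-ε} ≤ p^{(2-δ)/(2+δ)} ≤ n^{2-δ} ≤ |A c||B c|`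
    intro c
    have hexp : 1 - ε ≤ (2 - δ) / (2 + δ) := by
      rw [le_div_iff₀ h2δ]
      nlinarith [mul_pos hε hδ]
    calc (p : ℝ) ^ (1 - ε) ≤ (p : ℝ) ^ ((2 - δ) / (2 + δ)) :=
          Real.rpow_le_rpow_of_exponent_le hp1R hexp
      _ ≤ ((n : ℝ) ^ (2 + δ)) ^ ((2 - δ) / (2 + δ)) :=
          Real.rpow_le_rpow hp0R hpn (div_nonneg (by linarith) h2δ.le)
      _ = (n : ℝ) ^ (2 - δ) := by
          rw [← Real.rpow_mul hn0R, mul_div_cancel₀ _ h2δ.ne']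
      _ ≤ _ := hAB c

/-- **Capacity gadgets `↔ PrimeTwoFamilies`** (registered stub `capacityGadgets_iff_primeTwoFamilies`
of crux stmt-MatrixMultiplication-14308, explicit / elementary form).  (⇒) a capacity gadget family
gives every slice `0 < δ ≤ 1` of the crux by the landed transfer `stub_capacityTransfer` (code lift,
carry-free move into a prime cyclic host, bookkeeping), and the slices `δ > 1` by monotonicity
(`PrimeTwoFamiliesAt.mono`); (⇐) one-letter words, `capacityGadgets_of_primeTwoFamilies`. -/
theorem capacityGadgets_iff_primeTwoFamilies :
    (∀ ε : ℝ, 0 < ε → ∀ m₀ : ℕ, ∃ m ≥ m₀, ∃ r L : ℕ, ∃ P Q : Fin r → Finset (ZMod m),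
      ∃ W : Finset (Fin L → Fin r),
      (∀ c : Fin r, ∀ x ∈ P c, ∀ x' ∈ P c, ∀ y ∈ Q c, ∀ y' ∈ Q c,
          (x - x') + (y - y') = 0 → x = x' ∧ y = y') ∧
      (∀ i ∈ W, ∀ k ∈ W, i ≠ k → ∃ t : Fin L,
        ∀ p ∈ P (i t), ∀ q ∈ Q (k t), ∀ c : Fin r, ∀ p' ∈ P c, ∀ q' ∈ Q c, q - p ≠ q' - p') ∧
      1 ≤ L ∧
      ((m : ℝ) ^ (L : ℝ)) ^ (1 / 2 - ε) ≤ (W.card : ℝ) ∧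
      ∀ c : Fin r, (m : ℝ) ^ (1 - ε) ≤ (((P c).card * (Q c).card : ℕ) : ℝ)) ↔
    FourierTwoFamiliesModP.PrimeTwoFamilies := by
  refine ⟨fun hC => ?_, capacityGadgets_of_primeTwoFamilies⟩
  rw [primeTwoFamilies_iff]
  intro δ hδ
  by_cases h1 : δ ≤ 1
  · exact stub_capacityTransfer hC hδ h1
  · exact (stub_capacityTransfer hC one_pos le_rfl).mono (le_of_not_ge h1)

end Summit.MatrixMultiplication.MatrixMultiplication.Theorems.PrimeTwoFamilies.CapacityOneLetter
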